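import Summits.AtomisticToContinuum.FouriersLaw.Theorems.BondHeatUncertaintyExtensiveSnapshotIrreversibilityEnergyWindowDivergenceSeam

/-!
# Crux `ExtensiveSnapshotIrreversibility` (stmt-AtomisticToContinuum-9121), fixed-`N` half `K_fix`:
the DIVERGENCE LADDER — the level-set tail and the filter-form seam (node «DivergenceLadder», 2/6)

(helper file, theorem-side; decomp-a2c lens-1 «grading / quantitative ladder», generation 89;
continues `…EnergyWindowDivergenceSeam`: pointwise `t ≤ k ≤ (1 + |ψ|/2) t`, the one-state
level-set bound `KL ≤ (1 + η/2) Δ + ∫_{|ψ|>η} |ψ| e^{φ} dμ₀` and the necessity `Δ ≤ KL`.)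

* `setIntegral_abs_mul_exp_le_young` — the level-set tail by Young:
  `∫_A |ψ| e^{φ} dμ₀ ≤ (λᵖ/p) ∫ |ψ|ᵖ e^{φ} dμ₀ + (λ^{−q}/q) ∫_A e^{φ} dμ₀`;
* ★ `klDiv_flip_le_of_triangular` — filter form along a family `μ_δ = μ₀ · e^{φ_δ}`: (T2ₚ) an
  `Lᵖ(μ_δ)` moment of `ψ_δ` with polynomial blow-up (the landed atom A2ₚ) + (SPC) superpolynomial
  concentration `μ_δ(|ψ_δ| > η) ≤ |δ|ˢ` (every level `η > 0`, every order `s`) + (ΔSharp)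
  `Δ(μ_δ, Θ_*μ_δ) ≤ D' δ²` eventually for every `D' > D` ⟹ `KL(μ_δ ‖ Θ_*μ_δ) ≤ K δ²` eventually
  for every `K > D`.  No energy window, no density floor, no `L²(μ₀)`-response is used: the bulk
  `{|ψ_δ| ≤ η}` costs the factor `1 + η/2` (absorbed in `K > D`), the level-set tail is `O(|δ|³)`
  by Young with `λ = |δ|^{(r⁺+3)/p}` against (T2ₚ) and (SPC) at order `s = (r⁺+3)q/p + 3`.

No new objects. [folklore]
-/

noncomputable section

namespace Summit.AtomisticToContinuum.FouriersLaw.Theorems.ExtensiveSnapshotIrreversibility.EnergyWindow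

open MeasureTheory Filter Topology InformationTheory Real
open scoped ENNReal NNReal
open Literature.MathematicalPhysics.KineticTheory.HeatConduction
open Summit.AtomisticToContinuum.FouriersLaw.Theorems.ExtensiveSnapshotIrreversibility.Negative
open Summit.AtomisticToContinuum.FouriersLaw.Theorems.ExtensiveSnapshotIrreversibility.ClausiusBudget.OddLogDensity

variable {N : ℕ}

/-! ## 1. The level-set tail by Young -/

section Tail

variable (μ₀ : Measure (PhaseSpace N))

/-- **The level-set tail by Young.** For Hölder conjugate `p, q`, `λ > 0`, a measurable set `A` and
a
tilt with `|ψ|ᵖ e^{φ} ∈ L¹(μ₀)`: `|ψ| e^{φ} ∈ L¹(μ₀)` and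
`∫_A |ψ| e^{φ} dμ₀ ≤ (λᵖ/p) ∫ |ψ|ᵖ e^{φ} dμ₀ + (λ^{−q}/q) ∫_A e^{φ} dμ₀` (`|ψ| = (λ|ψ|)·λ⁻¹`).
[folklore] -/
theorem setIntegral_abs_mul_exp_le_young {p q lam : ℝ} (hpq : p.HolderConjugate q) (hlam : 0 < lam)
    {φ : PhaseSpace N → ℝ} (hφm : Measurable φ) (hexp : Integrable (fun x => exp (φ x)) μ₀)
    (hTp : Integrable (fun x => |φ x - φ (x.1, -x.2)| ^ p * exp (φ x)) μ₀)
    (A : Set (PhaseSpace N)) :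
    Integrable (fun x => |φ x - φ (x.1, -x.2)| * exp (φ x)) μ₀ ∧
      ∫ x in A, |φ x - φ (x.1, -x.2)| * exp (φ x) ∂μ₀ ≤
        lam ^ p / p * ∫ x, |φ x - φ (x.1, -x.2)| ^ p * exp (φ x) ∂μ₀ +
          (1 / lam) ^ q / q * ∫ x in A, exp (φ x) ∂μ₀ := by
  have hΘm : Measurable (fun x : PhaseSpace N => (x.1, -x.2)) := (momentumReversal N).measurable
  have hψm : Measurable (fun x => φ x - φ (x.1, -x.2)) := hφm.sub (hφm.comp hΘm)
  set B : PhaseSpace N → ℝ := fun x => lam ^ p / p * (|φ x - φ (x.1, -x.2)| ^ p * exp (φ x)) +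
    (1 / lam) ^ q / q * exp (φ x) with hB
  have hBi : Integrable B μ₀ := (hTp.const_mul _).add (hexp.const_mul _)
  have hpt : ∀ x, |φ x - φ (x.1, -x.2)| * exp (φ x) ≤ B x := fun x => by
    have h := mul_le_mul_of_nonneg_right (abs_le_young (x := φ x - φ (x.1, -x.2)) hpq hlam)
      (exp_pos (φ x)).le
    simp only [hB]
    nlinarith [h]
  have h1 : Integrable (fun x => |φ x - φ (x.1, -x.2)| * exp (φ x)) μ₀ := by
    refine hBi.mono' (hψm.abs.mul hφm.exp).aestronglyMeasurable (ae_of_all _ fun x => ?_)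
    rw [Real.norm_eq_abs, abs_of_nonneg (by positivity)]
    exact hpt x
  refine ⟨h1, ?_⟩
  have hp : 0 < p := hpq.pos
  have hq : 0 < q := hpq.symm.pos
  calc ∫ x in A, |φ x - φ (x.1, -x.2)| * exp (φ x) ∂μ₀ ≤ ∫ x in A, B x ∂μ₀ :=
        setIntegral_mono h1.integrableOn hBi.integrableOn hpt
    _ = lam ^ p / p * ∫ x in A, |φ x - φ (x.1, -x.2)| ^ p * exp (φ x) ∂μ₀ +
          (1 / lam) ^ q / q * ∫ x in A, exp (φ x) ∂μ₀ := by
        rw [hB, integral_add (hTp.const_mul _).integrableOn (hexp.const_mul _).integrableOn,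
          integral_const_mul, integral_const_mul]
    _ ≤ lam ^ p / p * ∫ x, |φ x - φ (x.1, -x.2)| ^ p * exp (φ x) ∂μ₀ +
          (1 / lam) ^ q / q * ∫ x in A, exp (φ x) ∂μ₀ := by
        have h := setIntegral_le_integral (s := A) hTp (ae_of_all _ fun x => by positivity)
        have hc : 0 ≤ lam ^ p / p := by positivity
        nlinarith [mul_le_mul_of_nonneg_left h hc]

end Tail

/-! ## 2. Along a family: `KL(μ_δ ‖ Θ_*μ_δ) ≤ K δ²` eventually, for every `K > D` -/

section Seam

variable (μ₀ : Measure (PhaseSpace N)) [IsProbabilityMeasure μ₀]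

/-- ★ **Abstract divergence-ladder seam (filter form).** For a family of tilts `μ_δ = μ₀ · e^{φ_δ}`
(`∫ e^{φ_δ} dμ₀ = 1` eventually in `δ ≠ 0`) of a flip-invariant probability measure `μ₀`,
`ψ_δ := φ_δ − φ_δ∘Θ`, and Hölder conjugate `p, q`:
(T2ₚ) `∫ |ψ_δ|ᵖ dμ_δ ≤ C₂ |δ|^{−r}` (polynomial blow-up allowed);
(SPC) for every level `η > 0` and every `s`, `μ_δ(|ψ_δ| > η) ≤ |δ|ˢ`;
(ΔSharp) `∫ (e^{φ_δ} − e^{φ_δ∘Θ})²/(e^{φ_δ} + e^{φ_δ∘Θ}) dμ₀ ≤ D' δ²` for every `D' > D`; all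
eventually
— imply `KL(μ_δ ‖ Θ_*μ_δ) ≤ K δ²` eventually for every `K > D` (`D' = (K + D)/2`, level
`η = (K − D')/(D' + 1)`, Young weight `λ = |δ|^{(r⁺+3)/p}`, `s = (r⁺ + 3)q/p + 3`: the level-set
tail
is `O(|δ|³)`).  No window, no floor, no `L²(μ₀)`-response. [folklore] -/
theorem klDiv_flip_le_of_triangular
    (hinv : μ₀.map (fun x : PhaseSpace N => (x.1, -x.2)) = μ₀)
    {C₂ r D p q : ℝ} (hpq : p.HolderConjugate q)
    (φ : ℝ → PhaseSpace N → ℝ) (hφm : ∀ δ, Measurable (φ δ))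
    (hZ : ∀ᶠ δ in 𝓝[≠] (0 : ℝ), Integrable (fun x => exp (φ δ x)) μ₀ ∧ ∫ x, exp (φ δ x) ∂μ₀ = 1)
    (hT2 : ∀ᶠ δ in 𝓝[≠] (0 : ℝ),
      Integrable (fun x => |φ δ x - φ δ (x.1, -x.2)| ^ p * exp (φ δ x)) μ₀ ∧
      ∫ x, |φ δ x - φ δ (x.1, -x.2)| ^ p * exp (φ δ x) ∂μ₀ ≤ C₂ * |δ| ^ (-r))
    (hSPC : ∀ η : ℝ, 0 < η → ∀ s : ℝ, ∀ᶠ δ in 𝓝[≠] (0 : ℝ),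
      ∫ x in {x | η < |φ δ x - φ δ (x.1, -x.2)|}, exp (φ δ x) ∂μ₀ ≤ |δ| ^ s)
    (hΔ : ∀ D' : ℝ, D < D' → ∀ᶠ δ in 𝓝[≠] (0 : ℝ),
      ∫ x, (exp (φ δ x) - exp (φ δ (x.1, -x.2))) ^ 2 / (exp (φ δ x) + exp (φ δ (x.1, -x.2))) ∂μ₀ ≤
        D' * δ ^ 2) :
    ∀ K : ℝ, D < K → ∀ᶠ δ in 𝓝[≠] (0 : ℝ),
      klDiv (μ₀.tilted (φ δ)) ((μ₀.tilted (φ δ)).map (fun x : PhaseSpace N => (x.1, -x.2))) ≤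
        ENNReal.ofReal (K * δ ^ 2) := by
  intro K hK
  have hp : 0 < p := hpq.pos
  have hq : 0 < q := hpq.symm.pos
  by_cases hD : 0 ≤ D
  swap
  · -- `D < 0`: (ΔSharp) at `D' = D/2 < 0` is eventually absurd, so anything holds eventually
    have hD2 : D < D / 2 := by linarith
    filter_upwards [hΔ (D / 2) hD2, self_mem_nhdsWithin] with δ hδ hne
    exfalso
    have h0 : 0 ≤ ∫ x, (exp (φ δ x) - exp (φ δ (x.1, -x.2))) ^ 2 /
        (exp (φ δ x) + exp (φ δ (x.1, -x.2))) ∂μ₀ := integral_nonneg fun x => triangular_nonneg _ _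
    have hδ2 : 0 < δ ^ 2 := by
      rw [← sq_abs]
      exact pow_pos (abs_pos.2 hne) 2
    nlinarith
  -- `D ≥ 0`: the target level `D' = (K + D)/2`, the gap `K − D'`, the level `η`
  set D' : ℝ := (K + D) / 2 with hD'
  have hDD' : D < D' := by rw [hD']; linarith
  have hD'0 : 0 ≤ D' := by rw [hD']; linarith
  have hgap : 0 < K - D' := by rw [hD']; linarith
  set η : ℝ := (K - D') / (D' + 1) with hη
  have hη0 : 0 < η := by rw [hη]; positivity
  have hηD : (1 + η / 2) * D' ≤ D' + (K - D') / 2 := by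
    have h1 : D' / (D' + 1) ≤ 1 := by rw [div_le_one (by linarith)]; linarith
    have e : (1 + η / 2) * D' = D' + (K - D') / 2 * (D' / (D' + 1)) := by
      rw [hη]
      field_simp
    rw [e]
    nlinarith [mul_le_mul_of_nonneg_left h1 (by linarith : 0 ≤ (K - D') / 2)]
  -- the exponents: blow-up `r⁺`, Young weight exponent `(r⁺ + 3)/p`, concentration order `s`
  set r' : ℝ := max r 0 with hr'
  have hr'0 : 0 ≤ r' := le_max_right _ _
  have hrr' : r ≤ r' := le_max_left _ _
  set s : ℝ := (r' + 3) * q / p + 3 with hs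
  set C₂' : ℝ := max C₂ 0 with hC₂'
  have hC₂' : 0 ≤ C₂' := le_max_right _ _
  have hC₂le : C₂ ≤ C₂' := le_max_left _ _
  have t_abs : Tendsto (fun δ : ℝ => |δ|) (𝓝[≠] (0 : ℝ)) (𝓝 0) := by
    have h := (continuous_abs.tendsto (0 : ℝ))
    rw [abs_zero] at h
    exact h.mono_left nhdsWithin_le_nhds
  have ev3 : ∀ᶠ δ in 𝓝[≠] (0 : ℝ), (C₂' / p + 1 / q) * |δ| < (K - D') / 2 := by
    have h := t_abs.const_mul (C₂' / p + 1 / q)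
    rw [mul_zero] at h
    exact h.eventually_lt_const (by linarith)
  have hone : ∀ᶠ δ in 𝓝[≠] (0 : ℝ), δ ≠ 0 ∧ |δ| < 1 := eventually_ne_and_abs_lt one_pos
  filter_upwards [hZ, hT2, hSPC η hη0 s, hΔ D' hDD', ev3, hone] with δ hZδ hT2δ hSδ hΔδ h3 hδ
  have hδ0 : 0 < |δ| := abs_pos.2 hδ.1
  have hδ1 : |δ| < 1 := hδ.2
  -- the Young weight `λ = |δ|^{(r⁺+3)/p}`
  set lam : ℝ := |δ| ^ ((r' + 3) / p) with hlam
  have hlampos : 0 < lam := by rw [hlam]; exact Real.rpow_pos_of_pos hδ0 _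
  have hlam_p : lam ^ p = |δ| ^ (r' + 3) := by
    rw [hlam, ← Real.rpow_mul hδ0.le]
    congr 1
    field_simp
  have hlam_q : (1 / lam) ^ q = |δ| ^ (-((r' + 3) * q / p)) := by
    rw [hlam, one_div, ← Real.rpow_neg hδ0.le, ← Real.rpow_mul hδ0.le]
    congr 1
    ring
  obtain ⟨h1, hyoung⟩ :=
    setIntegral_abs_mul_exp_le_young μ₀ hpq hlampos (hφm δ) hZδ.1 hT2δ.1
      {x : PhaseSpace N | η < |φ δ x - φ δ (x.1, -x.2)|}
  obtain ⟨hfin, hmain⟩ :=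
    toReal_klDiv_flip_tilted_le_triangular μ₀ hinv (hφm δ) hZδ.1 hZδ.2 hη0 h1
  rw [← ENNReal.ofReal_toReal hfin]
  refine ENNReal.ofReal_le_ofReal ?_
  -- the two tail terms are `O(|δ|³)`
  have hA' : lam ^ p / p * (C₂ * |δ| ^ (-r)) ≤ C₂' / p * (|δ| * δ ^ 2) := by
    rw [hlam_p]
    have h1' : C₂ * |δ| ^ (-r) ≤ C₂' * |δ| ^ (-r') :=
      calc C₂ * |δ| ^ (-r) ≤ C₂' * |δ| ^ (-r) :=
            mul_le_mul_of_nonneg_right hC₂le (Real.rpow_nonneg hδ0.le _)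
        _ ≤ C₂' * |δ| ^ (-r') := mul_le_mul_of_nonneg_left
            (Real.rpow_le_rpow_of_exponent_ge hδ0 hδ1.le (neg_le_neg hrr')) hC₂'
    have h2' : |δ| ^ (r' + 3) * |δ| ^ (-r') = |δ| * δ ^ 2 := by
      rw [← Real.rpow_add hδ0]
      have : r' + 3 + -r' = ((3 : ℕ) : ℝ) := by push_cast; ring
      rw [this, Real.rpow_natCast, ← sq_abs δ]
      ring
    have h3' : 0 ≤ |δ| ^ (r' + 3) / p := by positivity
    calc |δ| ^ (r' + 3) / p * (C₂ * |δ| ^ (-r)) ≤ |δ| ^ (r' + 3) / p * (C₂' * |δ| ^ (-r')) :=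
          mul_le_mul_of_nonneg_left h1' h3'
      _ = C₂' / p * (|δ| ^ (r' + 3) * |δ| ^ (-r')) := by ring
      _ = C₂' / p * (|δ| * δ ^ 2) := by rw [h2']
  have hB' : (1 / lam) ^ q / q * |δ| ^ s = 1 / q * (|δ| * δ ^ 2) := by
    rw [hlam_q]
    have h2' : |δ| ^ (-((r' + 3) * q / p)) * |δ| ^ s = |δ| * δ ^ 2 := by
      rw [← Real.rpow_add hδ0]
      have : -((r' + 3) * q / p) + s = ((3 : ℕ) : ℝ) := by rw [hs]; push_cast; ring
      rw [this, Real.rpow_natCast, ← sq_abs δ]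
      ring
    calc |δ| ^ (-((r' + 3) * q / p)) / q * |δ| ^ s
        = 1 / q * (|δ| ^ (-((r' + 3) * q / p)) * |δ| ^ s) := by ring
      _ = 1 / q * (|δ| * δ ^ 2) := by rw [h2']
  -- assemble
  have hc1 : 0 ≤ lam ^ p / p := by positivity
  have hc2 : 0 ≤ (1 / lam) ^ q / q := by positivity
  have htail : ∫ x in {x | η < |φ δ x - φ δ (x.1, -x.2)|}, |φ δ x - φ δ (x.1, -x.2)| *
      exp (φ δ x) ∂μ₀ ≤ C₂' / p * (|δ| * δ ^ 2) + 1 / q * (|δ| * δ ^ 2) := by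
    refine hyoung.trans ?_
    rw [← hB']
    exact add_le_add ((mul_le_mul_of_nonneg_left hT2δ.2 hc1).trans hA')
      (mul_le_mul_of_nonneg_left hSδ hc2)
  have hbulk : (1 + η / 2) * ∫ x, (exp (φ δ x) - exp (φ δ (x.1, -x.2))) ^ 2 /
      (exp (φ δ x) + exp (φ δ (x.1, -x.2))) ∂μ₀ ≤ (D' + (K - D') / 2) * δ ^ 2 :=
    calc (1 + η / 2) * ∫ x, (exp (φ δ x) - exp (φ δ (x.1, -x.2))) ^ 2 /
          (exp (φ δ x) + exp (φ δ (x.1, -x.2))) ∂μ₀ ≤ (1 + η / 2) * (D' * δ ^ 2) :=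
          mul_le_mul_of_nonneg_left hΔδ (by positivity)
      _ = (1 + η / 2) * D' * δ ^ 2 := by ring
      _ ≤ (D' + (K - D') / 2) * δ ^ 2 := mul_le_mul_of_nonneg_right hηD (sq_nonneg δ)
  have h3' : (C₂' / p + 1 / q) * |δ| * δ ^ 2 ≤ (K - D') / 2 * δ ^ 2 :=
    mul_le_mul_of_nonneg_right h3.le (sq_nonneg δ)
  nlinarith [hmain, htail, hbulk, h3']

end Seam

end Summit.AtomisticToContinuum.FouriersLaw.Theorems.ExtensiveSnapshotIrreversibility.EnergyWindow

end
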